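import Literature.NumberTheory.Sieve.BombieriFriedlanderIwaniecTheorem5Weights
import HarnessLib

/-!
# Bombieri–Friedlander–Iwaniec 1986, §3: the smooth majorant `𝒢*` and the dispersion `𝒢* = 𝒮₁ − 2𝒮₂ + 𝒮₃`

Topic `Literature/NumberTheory/Sieve`.  First file of the formalisation of the PROVABLE part
(§§3–8 up to (8.2)) of the proof of **Theorem 1** of E. Bombieri, J. B. Friedlander, H. Iwaniec,
*Primes in arithmetic progressions to large moduli*, Acta Math. 156 (1986), 203–251 (vendored as
the named fact `Literature.NumberTheory.Sieve.BombieriFriedlanderIwaniecTheorem1` in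
`…BombieriFriedlanderIwaniecDispersion`), whose only non-elementary input is BFI's Lemma 6 (from
Lemma 1 = the Deshouillers–Iwaniec bounds for sums of Kloosterman sums).  This file is §3
(p. 214–215), which is common to Theorems 1–4: the smooth majorant and Linnik's dispersion.
Everything here is PROVED; no named facts are introduced.

## Contents (BFI §3, pp. 214–215)

* `BFI.dispGw a S N Q R w β γ` — the sum `𝒢` of p. 214 with the sharp range `m ∼ M` replaced by a
  weight `w(m)` over a finite range `S` (the companion of `BFI.dispDw` of `…Theorem5Weights`);
  `BFI.dispG_eq_dispGw`; **`BFI.dispG_le_dispGw`** (p. 214: "we enlarge `𝒢` a bit by introducing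
  a smooth weight function `f(m) ≥ 0` in front of `{ }²` … In this way we obtain a smooth majorant
  `𝒢*`"): `𝒢 ≤ 𝒢*(w)` whenever `w ≥ 0` on `S ⊇ {m ∼ M}` and `w = 1` on `{m ∼ M}`, and its instance
  `BFI.dispG_le_dispGw_bump` for BFI's weight `BFI.bump M Y` over `BFI.mRange M Y`.
* `BFI.eps` (the bracket `[mn ≡ a (d)] − [(n,d)=1]/φ(d)`), `BFI.innerDisc_eq_sum`,
  `BFI.braceSum_eq_sum_sum`, `BFI.sq_sum_sum` — squaring out.
* `BFI.Cop a r q₁ q₂ m` (the conditions `(r, am) = (q₁, am) = (q₂, am) = 1`, i.e.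
  `(q₁q₂r, a) = 1 ∧ (m, q₁q₂r) = 1`, `BFI.cop_iff`), and the three `m`-sums of (3.4) with the
  `m`-summation innermost: `BFI.mA1` (`𝒮₁`: both congruences `mn₁ ≡ a (q₁r)`, `mn₂ ≡ a (q₂r)`),
  `BFI.mA2` (`𝒮₂`: one congruence), `BFI.mA3` (`𝒮₃`: none); `BFI.copW n d = [(n,d)=1]/φ(d)`.
* `BFI.dS1`, `BFI.dS2`, `BFI.dS3` — `𝒮₁, 𝒮₂, 𝒮₃` of (3.4) as finite sums over
  `r ∼ R, q₁, q₂ ∼ Q, n₁, n₂ ∼ N` of `γ_{q₁} γ_{q₂} β_{n₁} β_{n₂} × (A₁ | copW·A₂ | copW copW·A₃)`.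
* **`BFI.dispGw_eq_dS`** — Linnik's dispersion (3.4): `𝒢*(w) = 𝒮₁ − 2𝒮₂ + 𝒮₃`, an EXACT identity
  for every weight, range and all real coefficients (the two cross terms are equal by the symmetry
  `(q₁, n₁) ↔ (q₂, n₂)`, `BFI.dS2_symm`).
* Support and size of the `m`-sums: `BFI.mA3_eq` (`A₃ = [(q₁q₂r,a)=1] ∑_{(m,q₁q₂r)=1} w`),
  `BFI.mA2_eq_zero_of_not_coprime`, `BFI.mA1_eq_zero_of_not_coprime` (the congruences force
  `(nᵢ, qᵢr) = 1`), `0 ≤ A₁ ≤ A₂ ≤ A₃ ≤ ∑ w` for `w ≥ 0`, `0 ≤ copW ≤ 1/φ`.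

## Faithfulness

BFI define `𝒮₁, 𝒮₂, 𝒮₃` on p. 215 with the constraints `r ∼ R, q ∼ Q, n ∼ N` "omitted for
notational simplicity"; here they are explicit finite sums, the weight `f` is an arbitrary real
`w` on a finite range `S` (BFI's `f` is `BFI.bump`), and the coprimality conditions of `𝒢`
(`(r, am) = 1` outside the braces, `(q, am) = 1` inside) are carried by every term exactly as they
arise from squaring.  Nothing is estimated in this file.

## What comes next (not here)

§4 (`𝒮₃ = f̂(0)X + O(N‖β‖²R⁻¹ℒ^B)`), §5 (`𝒮₂`), §6 (`𝒮₁ = f̂(0)𝒳 + ℛ₁ + …`), §7 (`𝒳` versus `X`,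
from Theorem 0 (a) = `BombieriFriedlanderIwaniecTheorem0a` of `…DispersionProofs`), §8 (8.2)
(`ℛ₁` versus the sum `𝒜` = `BFI.dispA` of `…Theorem5Reciprocity`), and Theorem 1 from Lemma 6.

## References

* E. Bombieri, J. B. Friedlander, H. Iwaniec, *Primes in arithmetic progressions to large moduli*,
  Acta Math. 156 (1986), 203–251, §3 pp. 214–215, (3.3)–(3.4). [BombieriFriedlanderIwaniecActa1986]
-/

noncomputable section

open Finset Real
open scoped ArithmeticFunction.sigma

namespace Literature.NumberTheory.Sieve

namespace BFI

/-! ### `𝒢` with a weight on the variable `m` -/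

/-- The sum `𝒢(M, N, Q, R)` of BFI p. 214 with the sharp range `m ∼ M` replaced by a real weight
`w(m)` summed over a finite set `S` of integers `m` (BFI §3, p. 214: "we enlarge `𝒢` a bit by
introducing a smooth weight function `f(m) ≥ 0` in front of `{ }²`"):
`∑_{r ∼ R} ∑_{m ∈ S, (r, am) = 1} w(m) {∑_{q ∼ Q, (q, am) = 1} γ_q (…)}²`.
[cite: BombieriFriedlanderIwaniecActa1986, §3 p. 214] -/
def dispGw (a : ℤ) (S : Finset ℕ) (N Q R : ℝ) (w β γ : ℕ → ℝ) : ℝ :=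
  ∑ r ∈ dyadic R, ∑ m ∈ S,
    if IsCoprime (r : ℤ) (a * m) then w m * braceSum a N Q β γ r m ^ 2 else 0

/-- `𝒢` is `dispGw` with `S = {m ∼ M}` and the weight `1`. [folklore] -/
theorem dispG_eq_dispGw (a : ℤ) (M N Q R : ℝ) (β γ : ℕ → ℝ) :
    dispG a M N Q R β γ = dispGw a (dyadic M) N Q R (fun _ => 1) β γ := by
  unfold dispG dispGw
  simp only [one_mul]

/-- **The smooth majorant** (BFI p. 214): if `w ≥ 0` on `S ⊇ {m ∼ M}` and `w = 1` on `{m ∼ M}`, then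
`𝒢 ≤ 𝒢*(w)`. [cite: BombieriFriedlanderIwaniecActa1986, §3 p. 214] -/
theorem dispG_le_dispGw (a : ℤ) {M : ℝ} {S : Finset ℕ} (hS : dyadic M ⊆ S) (N Q R : ℝ)
    {w : ℕ → ℝ} (hw0 : ∀ m ∈ S, 0 ≤ w m) (hw1 : ∀ m ∈ dyadic M, w m = 1) (β γ : ℕ → ℝ) :
    dispG a M N Q R β γ ≤ dispGw a S N Q R w β γ := by
  unfold dispG dispGw
  refine Finset.sum_le_sum fun r _ => ?_
  calc ∑ m ∈ dyadic M, (if IsCoprime (r : ℤ) (a * m) then braceSum a N Q β γ r m ^ 2 else 0)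
      = ∑ m ∈ dyadic M,
          (if IsCoprime (r : ℤ) (a * m) then w m * braceSum a N Q β γ r m ^ 2 else 0) := by
        refine Finset.sum_congr rfl fun m hm => ?_
        rw [hw1 m hm, one_mul]
    _ ≤ ∑ m ∈ S, (if IsCoprime (r : ℤ) (a * m) then w m * braceSum a N Q β γ r m ^ 2 else 0) := by
        refine Finset.sum_le_sum_of_subset_of_nonneg hS fun m hmS _ => ?_
        split_ifs
        · exact mul_nonneg (hw0 m hmS) (sq_nonneg _)
        · exact le_rfl

/-- The smooth majorant with BFI's weight: for `0 < Y`, `0 ≤ M`,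
`𝒢(M,N,Q,R) ≤ 𝒢*(bump M Y)` summed over `m ∈ mRange M Y`. [cite: BombieriFriedlanderIwaniecActa1986, §3 p. 214] -/
theorem dispG_le_dispGw_bump (a : ℤ) {M Y : ℝ} (hY : 0 < Y) (hM : 0 ≤ M) (N Q R : ℝ) (β γ : ℕ → ℝ) :
    dispG a M N Q R β γ ≤ dispGw a (mRange M Y) N Q R (fun m => bump M Y m) β γ := by
  refine dispG_le_dispGw a (dyadic_subset_mRange hY.le) N Q R (fun m _ => (bump_mem_Icc hY hM _).1)
    (fun m hm => ?_) β γ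
  have h := (mem_dyadic hM).1 hm
  exact bump_eq_one hY h.1.le h.2

/-! ### The bracket as a sum over `n` -/

/-- The bracket indicator `[mn ≡ a (mod d)] − [(n, d) = 1]/φ(d)` of BFI p. 214. [folklore] -/
def eps (a : ℤ) (d m n : ℕ) : ℝ :=
  (if ((m * n : ℕ) : ZMod d) = (a : ZMod d) then (1 : ℝ) else 0) -
    (if n.Coprime d then (1 : ℝ) else 0) / (Nat.totient d : ℝ)

/-- `innerDisc(d, m) = ∑_{n ∼ N} β_n ([mn ≡ a (d)] − [(n,d)=1]/φ(d))`. [folklore] -/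
theorem innerDisc_eq_sum (a : ℤ) (N : ℝ) (β : ℕ → ℝ) (d m : ℕ) :
    innerDisc a N β d m = ∑ n ∈ dyadic N, β n * eps a d m n := by
  unfold innerDisc eps
  rw [Finset.sum_div, ← Finset.sum_sub_distrib]
  refine Finset.sum_congr rfl fun n _ => ?_
  split_ifs <;> ring

/-- The braces of `𝒢` as a double sum:
`{…} = ∑_{q ∼ Q} ∑_{n ∼ N} [(q, am) = 1] γ_q β_n ([mn ≡ a (qr)] − [(n,qr)=1]/φ(qr))`. [folklore] -/
theorem braceSum_eq_sum_sum (a : ℤ) (N Q : ℝ) (β γ : ℕ → ℝ) (r m : ℕ) :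
    braceSum a N Q β γ r m =
      ∑ q ∈ dyadic Q, ∑ n ∈ dyadic N,
        (if IsCoprime (q : ℤ) (a * m) then (1 : ℝ) else 0) * (γ q * β n * eps a (q * r) m n) := by
  unfold braceSum
  refine Finset.sum_congr rfl fun q _ => ?_
  split_ifs with h
  · rw [innerDisc_eq_sum, Finset.mul_sum]
    refine Finset.sum_congr rfl fun n _ => ?_
    ring
  · simp

/-- `(∑_q ∑_n T(q,n))² = ∑_{q₁} ∑_{q₂} ∑_{n₁} ∑_{n₂} T(q₁,n₁) T(q₂,n₂)`. [folklore] -/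
theorem sq_sum_sum {ι κ : Type*} (s : Finset ι) (t : Finset κ) (T : ι → κ → ℝ) :
    (∑ q ∈ s, ∑ n ∈ t, T q n) ^ 2 =
      ∑ q₁ ∈ s, ∑ q₂ ∈ s, ∑ n₁ ∈ t, ∑ n₂ ∈ t, T q₁ n₁ * T q₂ n₂ := by
  rw [sq, Finset.sum_mul_sum]
  refine Finset.sum_congr rfl fun q₁ _ => Finset.sum_congr rfl fun q₂ _ => ?_
  rw [Finset.sum_mul_sum]

/-! ### The coprimality conditions and the three `m`-sums -/

/-- The coprimality conditions of `𝒢` at `(r, q₁, q₂, m)`: `(r, am) = (q₁, am) = (q₂, am) = 1`.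
[cite: BombieriFriedlanderIwaniecActa1986, §3 p. 214] -/
abbrev Cop (a : ℤ) (r q₁ q₂ m : ℕ) : Prop :=
  IsCoprime (r : ℤ) (a * m) ∧ IsCoprime (q₁ : ℤ) (a * m) ∧ IsCoprime (q₂ : ℤ) (a * m)

/-- `Cop` is symmetric in `q₁, q₂`. [folklore] -/
theorem cop_comm (a : ℤ) (r q₁ q₂ m : ℕ) : Cop a r q₁ q₂ m ↔ Cop a r q₂ q₁ m := by
  unfold Cop; tauto

/-- **`A₁`**, the `m`-sum of `𝒮₁` (BFI p. 215) at `(r, q₁, q₂, n₁, n₂)`: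
`∑_{m ∈ S, (q₁q₂r, am) = 1, mn₁ ≡ a (q₁r), mn₂ ≡ a (q₂r)} w(m)`.
[cite: BombieriFriedlanderIwaniecActa1986, §3 p. 215] -/
def mA1 (a : ℤ) (S : Finset ℕ) (w : ℕ → ℝ) (r q₁ q₂ n₁ n₂ : ℕ) : ℝ :=
  ∑ m ∈ S, if Cop a r q₁ q₂ m ∧ ((m * n₁ : ℕ) : ZMod (q₁ * r)) = (a : ZMod (q₁ * r)) ∧
      ((m * n₂ : ℕ) : ZMod (q₂ * r)) = (a : ZMod (q₂ * r)) then w m else 0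

/-- **`A₂`**, the `m`-sum of `𝒮₂` (BFI p. 215) at `(r, q₁, q₂, n₁)`:
`∑_{m ∈ S, (q₁q₂r, am) = 1, mn₁ ≡ a (q₁r)} w(m)`.
[cite: BombieriFriedlanderIwaniecActa1986, §3 p. 215] -/
def mA2 (a : ℤ) (S : Finset ℕ) (w : ℕ → ℝ) (r q₁ q₂ n₁ : ℕ) : ℝ :=
  ∑ m ∈ S, if Cop a r q₁ q₂ m ∧ ((m * n₁ : ℕ) : ZMod (q₁ * r)) = (a : ZMod (q₁ * r)) then w m else 0

/-- **`A₃`**, the `m`-sum of `𝒮₃` (BFI p. 215) at `(r, q₁, q₂)`: `∑_{m ∈ S, (q₁q₂r, am) = 1} w(m)`.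
[cite: BombieriFriedlanderIwaniecActa1986, §3 p. 215] -/
def mA3 (a : ℤ) (S : Finset ℕ) (w : ℕ → ℝ) (r q₁ q₂ : ℕ) : ℝ :=
  ∑ m ∈ S, if Cop a r q₁ q₂ m then w m else 0

/-- The coprimality weight `[(n, d) = 1]/φ(d)` of the second half of the bracket. [folklore] -/
def copW (n d : ℕ) : ℝ := (if n.Coprime d then (1 : ℝ) else 0) / (Nat.totient d : ℝ)

/-- **`𝒮₁`** of BFI (3.4), p. 215, with the `m`-sum innermost:
`∑_{r∼R} ∑_{q₁,q₂∼Q} ∑_{n₁,n₂∼N} γ_{q₁} γ_{q₂} β_{n₁} β_{n₂} A₁(r,q₁,q₂,n₁,n₂)`.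
[cite: BombieriFriedlanderIwaniecActa1986, §3 (3.4) p. 215] -/
def dS1 (a : ℤ) (S : Finset ℕ) (N Q R : ℝ) (w β γ : ℕ → ℝ) : ℝ :=
  ∑ r ∈ dyadic R, ∑ q₁ ∈ dyadic Q, ∑ q₂ ∈ dyadic Q, ∑ n₁ ∈ dyadic N, ∑ n₂ ∈ dyadic N,
    γ q₁ * γ q₂ * β n₁ * β n₂ * mA1 a S w r q₁ q₂ n₁ n₂

/-- **`𝒮₂`** of BFI (3.4), p. 215, with the `m`-sum innermost:
`∑ γ_{q₁} γ_{q₂} β_{n₁} β_{n₂} [(n₂, q₂r) = 1]/φ(q₂r) · A₂(r,q₁,q₂,n₁)`.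
[cite: BombieriFriedlanderIwaniecActa1986, §3 (3.4) p. 215] -/
def dS2 (a : ℤ) (S : Finset ℕ) (N Q R : ℝ) (w β γ : ℕ → ℝ) : ℝ :=
  ∑ r ∈ dyadic R, ∑ q₁ ∈ dyadic Q, ∑ q₂ ∈ dyadic Q, ∑ n₁ ∈ dyadic N, ∑ n₂ ∈ dyadic N,
    γ q₁ * γ q₂ * β n₁ * β n₂ * copW n₂ (q₂ * r) * mA2 a S w r q₁ q₂ n₁

/-- **`𝒮₃`** of BFI (3.4), p. 215, with the `m`-sum innermost:
`∑ γ_{q₁} γ_{q₂} β_{n₁} β_{n₂} [(n₁,q₁r)=1][(n₂,q₂r)=1]/(φ(q₁r)φ(q₂r)) · A₃(r,q₁,q₂)`.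
[cite: BombieriFriedlanderIwaniecActa1986, §3 (3.4) p. 215] -/
def dS3 (a : ℤ) (S : Finset ℕ) (N Q R : ℝ) (w β γ : ℕ → ℝ) : ℝ :=
  ∑ r ∈ dyadic R, ∑ q₁ ∈ dyadic Q, ∑ q₂ ∈ dyadic Q, ∑ n₁ ∈ dyadic N, ∑ n₂ ∈ dyadic N,
    γ q₁ * γ q₂ * β n₁ * β n₂ * (copW n₁ (q₁ * r) * copW n₂ (q₂ * r)) * mA3 a S w r q₁ q₂


/-! ### The dispersion: `𝒢*(w) = 𝒮₁ − 2𝒮₂ + 𝒮₃` -/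

/-- `eps = [congruence] − copW`. [folklore] -/
theorem eps_eq (a : ℤ) (d m n : ℕ) :
    eps a d m n = (if ((m * n : ℕ) : ZMod d) = (a : ZMod d) then (1 : ℝ) else 0) - copW n d := rfl

/-- Squaring out one term of `𝒢*` (BFI p. 215, "Squaring out"): for fixed `(r, q₁, q₂, n₁, n₂, m)`,
`[Cop] w(m) ε₁ ε₂ = [Cop ∧ ≡₁ ∧ ≡₂] w − copW₂ [Cop ∧ ≡₁] w − copW₁ [Cop ∧ ≡₂] w + copW₁ copW₂ [Cop] w`.
[cite: BombieriFriedlanderIwaniecActa1986, §3 (3.4) p. 215] -/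
theorem cop_mul_eps_mul_eps (a : ℤ) (w : ℕ → ℝ) (r q₁ q₂ n₁ n₂ m : ℕ) :
    (if Cop a r q₁ q₂ m then (1 : ℝ) else 0) * (w m * eps a (q₁ * r) m n₁ * eps a (q₂ * r) m n₂) =
      (if Cop a r q₁ q₂ m ∧ ((m * n₁ : ℕ) : ZMod (q₁ * r)) = (a : ZMod (q₁ * r)) ∧
            ((m * n₂ : ℕ) : ZMod (q₂ * r)) = (a : ZMod (q₂ * r)) then w m else 0)
        - copW n₂ (q₂ * r) *
            (if Cop a r q₁ q₂ m ∧ ((m * n₁ : ℕ) : ZMod (q₁ * r)) = (a : ZMod (q₁ * r))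
              then w m else 0)
        - copW n₁ (q₁ * r) *
            (if Cop a r q₂ q₁ m ∧ ((m * n₂ : ℕ) : ZMod (q₂ * r)) = (a : ZMod (q₂ * r))
              then w m else 0)
        + copW n₁ (q₁ * r) * copW n₂ (q₂ * r) * (if Cop a r q₁ q₂ m then w m else 0) := by
  rw [eps_eq, eps_eq]
  simp only [Cop, ite_and]
  split_ifs <;> ring

/-- The `m`-sum of one term of `𝒢*`, expanded (BFI (3.4) at fixed `r, q₁, q₂, n₁, n₂`):
`∑_m [Cop] w ε₁ ε₂ = A₁ − copW₂ A₂(n₁) − copW₁ A₂'(n₂) + copW₁ copW₂ A₃`.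
[cite: BombieriFriedlanderIwaniecActa1986, §3 (3.4) p. 215] -/
theorem sum_cop_mul_eps_mul_eps (a : ℤ) (S : Finset ℕ) (w : ℕ → ℝ) (r q₁ q₂ n₁ n₂ : ℕ) :
    ∑ m ∈ S, (if Cop a r q₁ q₂ m then (1 : ℝ) else 0) *
        (w m * eps a (q₁ * r) m n₁ * eps a (q₂ * r) m n₂) =
      mA1 a S w r q₁ q₂ n₁ n₂ - copW n₂ (q₂ * r) * mA2 a S w r q₁ q₂ n₁
        - copW n₁ (q₁ * r) * mA2 a S w r q₂ q₁ n₂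
        + copW n₁ (q₁ * r) * copW n₂ (q₂ * r) * mA3 a S w r q₁ q₂ := by
  unfold mA1 mA2 mA3
  rw [Finset.mul_sum, Finset.mul_sum, Finset.mul_sum, ← Finset.sum_sub_distrib,
    ← Finset.sum_sub_distrib, ← Finset.sum_add_distrib]
  exact Finset.sum_congr rfl fun m _ => cop_mul_eps_mul_eps a w r q₁ q₂ n₁ n₂ m

/-- `𝒢*(w)` with the square expanded and the `m`-sum innermost. [folklore] -/
theorem dispGw_eq_sum₆ (a : ℤ) (S : Finset ℕ) (N Q R : ℝ) (w β γ : ℕ → ℝ) :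
    dispGw a S N Q R w β γ =
      ∑ r ∈ dyadic R, ∑ q₁ ∈ dyadic Q, ∑ q₂ ∈ dyadic Q, ∑ n₁ ∈ dyadic N, ∑ n₂ ∈ dyadic N,
        γ q₁ * γ q₂ * β n₁ * β n₂ *
          ∑ m ∈ S, (if Cop a r q₁ q₂ m then (1 : ℝ) else 0) *
            (w m * eps a (q₁ * r) m n₁ * eps a (q₂ * r) m n₂) := by
  -- expand the square and distribute `[(r,am)=1] w(m)` inside
  have h1 : dispGw a S N Q R w β γ =
      ∑ r ∈ dyadic R, ∑ m ∈ S, ∑ q₁ ∈ dyadic Q, ∑ q₂ ∈ dyadic Q, ∑ n₁ ∈ dyadic N,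
        ∑ n₂ ∈ dyadic N, γ q₁ * γ q₂ * β n₁ * β n₂ *
          ((if Cop a r q₁ q₂ m then (1 : ℝ) else 0) *
            (w m * eps a (q₁ * r) m n₁ * eps a (q₂ * r) m n₂)) := by
    unfold dispGw
    refine Finset.sum_congr rfl fun r _ => Finset.sum_congr rfl fun m _ => ?_
    rw [braceSum_eq_sum_sum, sq_sum_sum]
    by_cases hr : IsCoprime (r : ℤ) (a * m)
    · rw [if_pos hr, Finset.mul_sum]
      refine Finset.sum_congr rfl fun q₁ _ => ?_
      rw [Finset.mul_sum]
      refine Finset.sum_congr rfl fun q₂ _ => ?_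
      rw [Finset.mul_sum]
      refine Finset.sum_congr rfl fun n₁ _ => ?_
      rw [Finset.mul_sum]
      refine Finset.sum_congr rfl fun n₂ _ => ?_
      by_cases h1 : IsCoprime (q₁ : ℤ) (a * m) <;> by_cases h2 : IsCoprime (q₂ : ℤ) (a * m)
      · rw [if_pos h1, if_pos h2, if_pos (show Cop a r q₁ q₂ m from ⟨hr, h1, h2⟩)]; ring
      · rw [if_pos h1, if_neg h2, if_neg (show ¬Cop a r q₁ q₂ m from fun h => h2 h.2.2)]; ring
      · rw [if_neg h1, if_neg (show ¬Cop a r q₁ q₂ m from fun h => h1 h.2.1)]; ring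
      · rw [if_neg h1, if_neg (show ¬Cop a r q₁ q₂ m from fun h => h1 h.2.1)]; ring
    · rw [if_neg hr]
      symm
      refine Finset.sum_eq_zero fun q₁ _ => Finset.sum_eq_zero fun q₂ _ =>
        Finset.sum_eq_zero fun n₁ _ => Finset.sum_eq_zero fun n₂ _ => ?_
      rw [if_neg (show ¬Cop a r q₁ q₂ m from fun h => hr h.1)]
      ring
  rw [h1]
  refine Finset.sum_congr rfl fun r _ => ?_
  rw [Finset.sum_comm]
  refine Finset.sum_congr rfl fun q₁ _ => ?_
  rw [Finset.sum_comm]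
  refine Finset.sum_congr rfl fun q₂ _ => ?_
  rw [Finset.sum_comm]
  refine Finset.sum_congr rfl fun n₁ _ => ?_
  rw [Finset.sum_comm]
  refine Finset.sum_congr rfl fun n₂ _ => ?_
  rw [Finset.mul_sum]

/-- The symmetry `𝒮₂' = 𝒮₂`: the cross term with the congruence on `(n₂, q₂)` equals the one with
the congruence on `(n₁, q₁)` after renaming. [folklore] -/
theorem dS2_symm (a : ℤ) (S : Finset ℕ) (N Q R : ℝ) (w β γ : ℕ → ℝ) :
    ∑ r ∈ dyadic R, ∑ q₁ ∈ dyadic Q, ∑ q₂ ∈ dyadic Q, ∑ n₁ ∈ dyadic N, ∑ n₂ ∈ dyadic N,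
        γ q₁ * γ q₂ * β n₁ * β n₂ * (copW n₁ (q₁ * r) * mA2 a S w r q₂ q₁ n₂) =
      dS2 a S N Q R w β γ := by
  unfold dS2
  refine Finset.sum_congr rfl fun r _ => ?_
  rw [Finset.sum_comm]
  refine Finset.sum_congr rfl fun x _ => Finset.sum_congr rfl fun y _ => ?_
  rw [Finset.sum_comm]
  refine Finset.sum_congr rfl fun u _ => Finset.sum_congr rfl fun v _ => ?_
  ring

/-- **Linnik's dispersion** (BFI (3.4), p. 215: "Squaring out in `𝒢*(M, N, Q, R)` we obtain
`𝒢* = 𝒮₁ − 2𝒮₂ + 𝒮₃`"), as an exact identity for the weighted sum `dispGw` and the sums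
`dS1, dS2, dS3` (with their `m`-sums `A₁, A₂, A₃` innermost), for every weight `w`, range `S` and all
real coefficients. [cite: BombieriFriedlanderIwaniecActa1986, §3 (3.4) p. 215] -/
theorem dispGw_eq_dS (a : ℤ) (S : Finset ℕ) (N Q R : ℝ) (w β γ : ℕ → ℝ) :
    dispGw a S N Q R w β γ =
      dS1 a S N Q R w β γ - 2 * dS2 a S N Q R w β γ + dS3 a S N Q R w β γ := by
  have key : ∀ r q₁ q₂ n₁ n₂ : ℕ,
      γ q₁ * γ q₂ * β n₁ * β n₂ *
          ∑ m ∈ S, (if Cop a r q₁ q₂ m then (1 : ℝ) else 0) *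
            (w m * eps a (q₁ * r) m n₁ * eps a (q₂ * r) m n₂) =
        γ q₁ * γ q₂ * β n₁ * β n₂ * mA1 a S w r q₁ q₂ n₁ n₂
          - γ q₁ * γ q₂ * β n₁ * β n₂ * copW n₂ (q₂ * r) * mA2 a S w r q₁ q₂ n₁
          - γ q₁ * γ q₂ * β n₁ * β n₂ * (copW n₁ (q₁ * r) * mA2 a S w r q₂ q₁ n₂)
          + γ q₁ * γ q₂ * β n₁ * β n₂ * (copW n₁ (q₁ * r) * copW n₂ (q₂ * r)) *
              mA3 a S w r q₁ q₂ := by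
    intro r q₁ q₂ n₁ n₂
    rw [sum_cop_mul_eps_mul_eps]
    ring
  rw [dispGw_eq_sum₆]
  simp only [key, Finset.sum_sub_distrib, Finset.sum_add_distrib]
  rw [dS2_symm]
  unfold dS1 dS2 dS3
  ring


/-! ### Structure of the coprimality conditions and of `A₁, A₂, A₃` -/

/-- `Cop a r q₁ q₂ m ↔ (q₁q₂r, a) = 1 ∧ (m, q₁q₂r) = 1`. [folklore] -/
theorem cop_iff (a : ℤ) (r q₁ q₂ m : ℕ) :
    Cop a r q₁ q₂ m ↔ IsCoprime ((q₁ * q₂ * r : ℕ) : ℤ) a ∧ m.Coprime (q₁ * q₂ * r) := by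
  simp only [Cop, Nat.cast_mul, IsCoprime.mul_left_iff, IsCoprime.mul_right_iff,
    Nat.isCoprime_iff_coprime, Nat.coprime_mul_iff_right]
  constructor
  · rintro ⟨⟨hra, hrm⟩, ⟨h1a, h1m⟩, ⟨h2a, h2m⟩⟩
    exact ⟨⟨⟨h1a, h2a⟩, hra⟩, ⟨Nat.coprime_comm.1 h1m, Nat.coprime_comm.1 h2m⟩,
      Nat.coprime_comm.1 hrm⟩
  · rintro ⟨⟨⟨h1a, h2a⟩, hra⟩, ⟨h1m, h2m⟩, hrm⟩
    exact ⟨⟨hra, Nat.coprime_comm.1 hrm⟩, ⟨h1a, Nat.coprime_comm.1 h1m⟩,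
      ⟨h2a, Nat.coprime_comm.1 h2m⟩⟩

/-- `A₃` vanishes unless `(q₁q₂r, a) = 1`, and then it is the sum of `w` over the `m ∈ S` coprime
to `q₁q₂r`. [folklore] -/
theorem mA3_eq (a : ℤ) (S : Finset ℕ) (w : ℕ → ℝ) (r q₁ q₂ : ℕ) :
    mA3 a S w r q₁ q₂ =
      if IsCoprime ((q₁ * q₂ * r : ℕ) : ℤ) a then
        ∑ m ∈ S.filter (fun m => m.Coprime (q₁ * q₂ * r)), w m else 0 := by
  unfold mA3
  split_ifs with h
  · rw [Finset.sum_filter]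
    refine Finset.sum_congr rfl fun m _ => ?_
    exact if_congr ((cop_iff a r q₁ q₂ m).trans (by tauto)) rfl rfl
  · refine Finset.sum_eq_zero fun m _ => ?_
    rw [if_neg (show ¬Cop a r q₁ q₂ m from fun hc => h ((cop_iff a r q₁ q₂ m).1 hc).1)]

/-- A congruence `mn ≡ a (mod d)` with `(d, a) = 1` forces `(n, d) = 1`. [folklore] -/
theorem coprime_of_congr {d m n : ℕ} {a : ℤ} (hd : IsCoprime (d : ℤ) a)
    (h : ((m * n : ℕ) : ZMod d) = (a : ZMod d)) : n.Coprime d := by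
  rw [mul_comm] at h
  exact (coprime_of_natCast_mul_eq hd h).symm

/-- Under `Cop`, `(q₁ r, a) = 1`. [folklore] -/
theorem isCoprime_mul_of_cop {a : ℤ} {r q₁ q₂ m : ℕ} (h : Cop a r q₁ q₂ m) :
    IsCoprime ((q₁ * r : ℕ) : ℤ) a := by
  rw [Nat.cast_mul]
  exact IsCoprime.mul_left (IsCoprime.of_mul_right_left h.2.1) (IsCoprime.of_mul_right_left h.1)

/-- `A₂(r, q₁, q₂, n₁) = 0` unless `(n₁, q₁r) = 1` (the congruence `mn₁ ≡ a (q₁r)` with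
`(q₁r, a) = 1` is otherwise empty). [folklore] -/
theorem mA2_eq_zero_of_not_coprime (a : ℤ) (S : Finset ℕ) (w : ℕ → ℝ) {r q₁ n₁ : ℕ} (q₂ : ℕ)
    (h : ¬n₁.Coprime (q₁ * r)) : mA2 a S w r q₁ q₂ n₁ = 0 := by
  unfold mA2
  refine Finset.sum_eq_zero fun m _ => ?_
  rw [if_neg]
  rintro ⟨hc, hmn⟩
  exact h (coprime_of_congr (isCoprime_mul_of_cop hc) hmn)

/-- `A₁(r, q₁, q₂, n₁, n₂) = 0` unless `(n₁, q₁r) = 1` and `(n₂, q₂r) = 1`. [folklore] -/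
theorem mA1_eq_zero_of_not_coprime (a : ℤ) (S : Finset ℕ) (w : ℕ → ℝ) {r q₁ q₂ n₁ n₂ : ℕ}
    (h : ¬(n₁.Coprime (q₁ * r) ∧ n₂.Coprime (q₂ * r))) : mA1 a S w r q₁ q₂ n₁ n₂ = 0 := by
  unfold mA1
  refine Finset.sum_eq_zero fun m _ => ?_
  rw [if_neg]
  rintro ⟨hc, hmn₁, hmn₂⟩
  exact h ⟨coprime_of_congr (isCoprime_mul_of_cop hc) hmn₁,
    coprime_of_congr (isCoprime_mul_of_cop ((cop_comm a r q₁ q₂ m).1 hc)) hmn₂⟩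

/-- For `w ≥ 0` on `S`: `0 ≤ A₁ ≤ A₂`. [folklore] -/
theorem mA1_nonneg_le {a : ℤ} {S : Finset ℕ} {w : ℕ → ℝ} (hw : ∀ m ∈ S, 0 ≤ w m)
    (r q₁ q₂ n₁ n₂ : ℕ) :
    0 ≤ mA1 a S w r q₁ q₂ n₁ n₂ ∧ mA1 a S w r q₁ q₂ n₁ n₂ ≤ mA2 a S w r q₁ q₂ n₁ := by
  unfold mA1 mA2
  refine ⟨Finset.sum_nonneg fun m hm => ?_, Finset.sum_le_sum fun m hm => ?_⟩
  · split_ifs <;> [exact hw m hm; exact le_rfl]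
  · by_cases h : Cop a r q₁ q₂ m ∧ ((m * n₁ : ℕ) : ZMod (q₁ * r)) = (a : ZMod (q₁ * r)) ∧
        ((m * n₂ : ℕ) : ZMod (q₂ * r)) = (a : ZMod (q₂ * r))
    · rw [if_pos h, if_pos ⟨h.1, h.2.1⟩]
    · rw [if_neg h]
      split_ifs <;> [exact hw m hm; exact le_rfl]

/-- For `w ≥ 0` on `S`: `0 ≤ A₂ ≤ A₃`. [folklore] -/
theorem mA2_nonneg_le {a : ℤ} {S : Finset ℕ} {w : ℕ → ℝ} (hw : ∀ m ∈ S, 0 ≤ w m)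
    (r q₁ q₂ n₁ : ℕ) :
    0 ≤ mA2 a S w r q₁ q₂ n₁ ∧ mA2 a S w r q₁ q₂ n₁ ≤ mA3 a S w r q₁ q₂ := by
  unfold mA2 mA3
  refine ⟨Finset.sum_nonneg fun m hm => ?_, Finset.sum_le_sum fun m hm => ?_⟩
  · split_ifs <;> [exact hw m hm; exact le_rfl]
  · by_cases h : Cop a r q₁ q₂ m ∧ ((m * n₁ : ℕ) : ZMod (q₁ * r)) = (a : ZMod (q₁ * r))
    · rw [if_pos h, if_pos h.1]
    · rw [if_neg h]
      split_ifs <;> [exact hw m hm; exact le_rfl]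

/-- For `w ≥ 0` on `S`: `0 ≤ A₃ ≤ ∑_{m ∈ S} w(m)`. [folklore] -/
theorem mA3_nonneg_le {a : ℤ} {S : Finset ℕ} {w : ℕ → ℝ} (hw : ∀ m ∈ S, 0 ≤ w m)
    (r q₁ q₂ : ℕ) :
    0 ≤ mA3 a S w r q₁ q₂ ∧ mA3 a S w r q₁ q₂ ≤ ∑ m ∈ S, w m := by
  unfold mA3
  refine ⟨Finset.sum_nonneg fun m hm => ?_, Finset.sum_le_sum fun m hm => ?_⟩ <;>
    split_ifs <;> first | exact hw m hm | exact le_rfl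

/-- `copW n d ∈ [0, 1/φ(d)]`, in particular `0 ≤ copW n d ≤ 1/φ(d)`. [folklore] -/
theorem copW_nonneg_le (n d : ℕ) : 0 ≤ copW n d ∧ copW n d ≤ 1 / (Nat.totient d : ℝ) := by
  unfold copW
  constructor
  · split_ifs <;> positivity
  · split_ifs
    · exact le_rfl
    · rw [zero_div]; positivity

end BFI

end Literature.NumberTheory.Sieve
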